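import Summits.AnomalousDissipation.AnomalousDissipation.Theorems.SolenoidalFractalHomogenisationLagrangianCarrierConstructionTowerStepSmooth
import Summits.AnomalousDissipation.AnomalousDissipation.Theorems.SolenoidalFractalHomogenisationLagrangianCarrierConstructionFlowsL
import HarnessLib

/-!
# K3L `LagrangianCarrierConstruction` (stmt-AnomalousDissipation-24913), line `birth`, stub `stub_flowsL`: the Lagrangian insertion with
# smooth levels and flows (helper; `--supports stmt-AnomalousDissipation-24913`)

Summits-side helper file (everything proved; no definitions, no named facts). `exists_isLagrangian_smooth` strengthens `…FlowsL.exists_isLagrangian`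
(the r21 statement of `stub_flowsL`) by four clauses of the per-level regularity package `LevelRegular` demanded by the re-registered stub
(skeleton r22/v4): every level field `b (m+1) t` and every displacement `disp m t s` is `C^∞` in space (`Torus.IsSmooth`), `X m s s = id`, and the
two-parameter group law `X m t s ∘ X m s r = X m t r`. Construction: the Lagrangian tower run with the invariant at all orders
(`…TowerStepSmooth.tower_step_smooth`); the inserted velocity `D(A t ∘ A w⁻¹) ∘ (A w ∘ A t⁻¹) · v ∘ (A w ∘ A t⁻¹)` is `C^∞` as a derivative of a
`C^∞` map applied to `C^∞` arguments, the displacement lifts to `A t ∘ A s⁻¹ − id`, and the group law is the lattice equivariance of the frames.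
The clauses of `LevelRegular` NOT delivered here — pointwise summability (R0) (false without the decay clause: evidence note on the item),
joint time-continuity and periodicity of the levels (need (W1), (W2), commensurability), uniform derivative bounds, weak divergence-freeness
and measure preservation — are left to the repaired stub. NOT a proof of anomalous dissipation (F-D1 is a frontier formal rung).
-/

set_option linter.dupNamespace false

noncomputable section

namespace Summit.AnomalousDissipation.AnomalousDissipation.Theorems.SolenoidalFractalHomogenisation.LagrangianCarrierConstruction

open Set Function Filter Topology Metric MeasureTheory
open scoped NNReal ContDiff
open Literature.Analysis Literature.Analysis.ODE Literature.Analysis.FunctionSpaces Literature.Analysis.FunctionSpaces.Torus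
open Literature.Analysis.FluidPDE Literature.Analysis.FluidPDE.LatticeShear
open Summit.AnomalousDissipation.AnomalousDissipation.Theorems.SolenoidalFractalHomogenisation.PermissibleCarrier (isSmooth_level)

/-- **The Lagrangian insertion exists over every carrier datum, with smooth levels and flows**: over ANY Lagrangian lattice
carrier datum there are level fields and Lagrangian displacements with the same bookkeeping, refresh windows and strain budgets which
satisfy `IsLagrangian`, every level field and every displacement is `C^∞` in space (`Torus.IsSmooth`), and the flow maps satisfy
`X m s s = id` and the two-parameter group law (clauses (L3a), (F1b), (F2a,b) of `LevelRegular`) (every displacement is the flow of the partial sum of the level fields, in integral form, and every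
level is the Eulerian lattice level pushed forward by the coarser flow from each refresh window's left end). Witness: the
Lagrangian tower of the module docstring. [cite: ArmstrongVicol2025, §2.2 (PDF pp. 12, 18: b_m = b_{m−1} + Σ_l 𝟙 v_m(t, X_{m−1}^{-1}(t,x,lτ″_m)); the flows X_m)] -/
theorem exists_isLagrangian_smooth : ∀ k (E : Literature.Analysis.FluidPDE.LatticeShear.LagrangianLatticeCarrier k), ∃ E' : Literature.Analysis.FluidPDE.LatticeShear.LagrangianLatticeCarrier k, E'.toFractalCarrierData = E.toFractalCarrierData ∧ E'.refresh = E.refresh ∧ E'.θ = E.θ ∧ E'.IsLagrangian ∧ (∀ m t, Torus.IsSmooth (E'.b (m + 1) t)) ∧ (∀ m t s, Torus.IsSmooth (E'.disp m t s)) ∧ (∀ m s, E'.X m s s = id) ∧ (∀ m t s r, E'.X m t s ∘ E'.X m s r = E'.X m t r) := by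
  intro k E
  -- the lifted Eulerian level fields and their admissibility
  obtain ⟨v, hv⟩ : ∃ v : ℕ → ℝ → EuclideanSpace ℝ (Fin 3) → EuclideanSpace ℝ (Fin 3),
      ∀ m t z, v m t z = E.toFractalCarrierData.level m t (proj z) := ⟨_, fun _ _ _ => rfl⟩
  have hvU : ∀ m, IsUniformlyLipschitzOn (v m) univ := fun m => by
    have e : v m = fun t z => E.toFractalCarrierData.level m t (proj z) := funext fun t => funext fun z => hv m t z
    rw [e]; exact isUniformlyLipschitzOn_level_proj _ m
  have hvper : ∀ m t z (n : Fin 3 → ℤ), v m t (z + latticeVec n) = v m t z := fun m t z n => by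
    rw [hv, hv, level_proj_add_latticeVec]
  have hvloc : ∀ m (n : ℕ), 1 ≤ n → ∀ r, ∃ ε > 0, ContDiffOn ℝ n (uncurry (v m)) (Icc r (r + ε) ×ˢ univ) ∧
      ContDiffOn ℝ n (uncurry (v m)) (Icc (r - ε) r ×ˢ univ) := fun m n hn r => by
    have e : v m = fun t z => E.toFractalCarrierData.level m t (proj z) := funext fun t => funext fun z => hv m t z
    rw [e]; exact exists_contDiffOn_slabs_level_proj (n := (n : ℕ∞)) _ m r
  have hvbdd : ∀ m, ∃ C : ℝ, ∀ t z, ‖v m t z‖ ≤ C := fun m =>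
    ⟨_, fun t z => by rw [hv]; exact norm_level_proj_le _ m t z⟩
  -- the tower invariant
  let INV : (ℝ → EuclideanSpace ℝ (Fin 3) ≃ EuclideanSpace ℝ (Fin 3)) → (ℝ → EuclideanSpace ℝ (Fin 3) → EuclideanSpace ℝ (Fin 3)) →
      Set ℝ → Prop := fun A B D =>
    (∀ t z (n : Fin 3 → ℤ), A t (z + latticeVec n) = A t z + latticeVec n) ∧
    (∀ (n : ℕ), 1 ≤ n → ∀ r, ∃ ε > 0, ContDiffOn ℝ n (fun p : ℝ × EuclideanSpace ℝ (Fin 3) => A p.1 p.2) (Icc r (r + ε) ×ˢ univ) ∧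
      ContDiffOn ℝ n (fun p : ℝ × EuclideanSpace ℝ (Fin 3) => A p.1 p.2) (Icc (r - ε) r ×ˢ univ)) ∧
    (∀ (n : ℕ), 1 ≤ n → ∀ r, ∃ ε > 0, ContDiffOn ℝ n (fun p : ℝ × EuclideanSpace ℝ (Fin 3) => (A p.1).symm p.2) (Icc r (r + ε) ×ˢ univ) ∧
      ContDiffOn ℝ n (fun p : ℝ × EuclideanSpace ℝ (Fin 3) => (A p.1).symm p.2) (Icc (r - ε) r ×ˢ univ)) ∧
    D.Countable ∧
    (∀ (n : ℕ), 1 ≤ n → ∀ t ∉ D, ∃ ε > 0, ContDiffOn ℝ n (fun p : ℝ × EuclideanSpace ℝ (Fin 3) => A p.1 p.2) (Icc (t - ε) (t + ε) ×ˢ univ)) ∧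
    (∀ (n : ℕ), 1 ≤ n → ∀ t ∉ D, ∃ ε > 0, ContDiffOn ℝ n (fun p : ℝ × EuclideanSpace ℝ (Fin 3) => (A p.1).symm p.2)
      (Icc (t - ε) (t + ε) ×ˢ univ)) ∧
    (∀ t ∉ D, ∀ z, HasDerivAt (fun τ => A τ z) (B t (A t z)) t) ∧
    (∀ t z (n : Fin 3 → ℤ), B t (z + latticeVec n) = B t z) ∧
    (∀ a b : ℝ, ∃ C : ℝ, ∀ t ∈ Icc a b, ∀ z, ‖B t z‖ ≤ C) ∧
    (∀ t ∉ D, ∀ z, ContinuousAt (uncurry B) (t, z)) ∧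
    (∀ a b : ℝ, ∃ K : ℝ, ∀ t ∈ Icc a b, ∀ z, ‖fderiv ℝ (A t) z‖ ≤ K) ∧
    (∀ a b : ℝ, ∃ K : ℝ, ∀ t ∈ Icc a b, ∀ z, ‖fderiv ℝ (fun y => (A t).symm y) z‖ ≤ K)
  -- the inserted velocity of level `m+1` over a coarse flow `A`
  let INS : ℕ → (ℝ → EuclideanSpace ℝ (Fin 3) ≃ EuclideanSpace ℝ (Fin 3)) → ℝ → EuclideanSpace ℝ (Fin 3) →
      EuclideanSpace ℝ (Fin 3) := fun m A t z =>
    fderiv ℝ (fun y => A t ((A ((⌊t / E.refresh (m + 1)⌋ : ℝ) * E.refresh (m + 1))).symm y))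
      (A ((⌊t / E.refresh (m + 1)⌋ : ℝ) * E.refresh (m + 1)) ((A t).symm z))
      (v (m + 1) t (A ((⌊t / E.refresh (m + 1)⌋ : ℝ) * E.refresh (m + 1)) ((A t).symm z)))
  have base : INV (fun _ => Equiv.refl _) (fun _ _ => 0) ∅ := by
    refine ⟨fun t z n => rfl, fun n _ r => ⟨1, one_pos, contDiff_snd.contDiffOn, contDiff_snd.contDiffOn⟩,
      fun n _ r => ⟨1, one_pos, contDiff_snd.contDiffOn, contDiff_snd.contDiffOn⟩, countable_empty,
      fun n _ t _ => ⟨1, one_pos, contDiff_snd.contDiffOn⟩, fun n _ t _ => ⟨1, one_pos, contDiff_snd.contDiffOn⟩,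
      fun t _ z => by simpa using hasDerivAt_const t z, fun t z n => rfl, fun a b => ⟨0, fun t _ z => by simp⟩,
      fun t _ z => continuous_const.continuousAt, fun a b => ⟨1, fun t _ z => ?_⟩, fun a b => ⟨1, fun t _ z => ?_⟩⟩
    · simp only [Equiv.coe_refl, fderiv_id]; exact ContinuousLinearMap.norm_id_le
    · simp only [Equiv.refl_symm, Equiv.coe_refl]
      rw [show (fun y : EuclideanSpace ℝ (Fin 3) => id y) = id from rfl, fderiv_id]; exact ContinuousLinearMap.norm_id_le
  have step : ∀ m A B D, INV A B D → ∃ A' D', INV A' (fun t z => B t z + INS m A t z) D' := by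
    intro m A B D h
    obtain ⟨i1, i3, i3', i4, i4a, i4b, i5, i7a, i7b, i7c, i8, i8'⟩ := h
    exact tower_step_smooth A B D i1 i3 i3' i4 i4a i4b i5 i7a i7b i7c i8 i8' (v (m + 1)) (hvU _) (hvper _) (hvloc _) (hvbdd _)
      (E.refresh (m + 1)) (E.refresh_pos _)
  -- the tower
  obtain ⟨A, Bs, Ds, hB0, hBsucc, hINV⟩ : ∃ (A : ℕ → ℝ → EuclideanSpace ℝ (Fin 3) ≃ EuclideanSpace ℝ (Fin 3))
      (Bs : ℕ → ℝ → EuclideanSpace ℝ (Fin 3) → EuclideanSpace ℝ (Fin 3)) (Ds : ℕ → Set ℝ),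
      Bs 0 = (fun _ _ => 0) ∧ (∀ m, Bs (m + 1) = fun t z => Bs m t z + INS m (A m) t z) ∧ ∀ m, INV (A m) (Bs m) (Ds m) := by
    let T : ℕ → {p : (ℝ → EuclideanSpace ℝ (Fin 3) ≃ EuclideanSpace ℝ (Fin 3)) ×
        (ℝ → EuclideanSpace ℝ (Fin 3) → EuclideanSpace ℝ (Fin 3)) × Set ℝ // INV p.1 p.2.1 p.2.2} :=
      fun m => Nat.rec ⟨(fun _ => Equiv.refl _, fun _ _ => 0, ∅), base⟩
        (fun m T => ⟨((step m T.1.1 T.1.2.1 T.1.2.2 T.2).choose, fun t z => T.1.2.1 t z + INS m T.1.1 t z,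
          (step m T.1.1 T.1.2.1 T.1.2.2 T.2).choose_spec.choose), (step m T.1.1 T.1.2.1 T.1.2.2 T.2).choose_spec.choose_spec⟩) m
    exact ⟨fun m => (T m).1.1, fun m => (T m).1.2.1, fun m => (T m).1.2.2, rfl, fun m => rfl, fun m => (T m).2⟩
  -- the level fields and displacements on the torus
  obtain ⟨bf, hb0, hbS⟩ : ∃ bf : ℕ → ℝ → UnitAddTorus (Fin 3) → EuclideanSpace ℝ (Fin 3),
      (∀ t x, bf 0 t x = 0) ∧ ∀ m t x, bf (m + 1) t x = INS m (A m) t (repr x) :=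
    ⟨fun m t x => match m with | 0 => 0 | m + 1 => INS m (A m) t (repr x), fun _ _ => rfl, fun _ _ _ => rfl⟩
  obtain ⟨dsp, hdsp⟩ : ∃ dsp : ℕ → ℝ → ℝ → UnitAddTorus (Fin 3) → EuclideanSpace ℝ (Fin 3),
      ∀ m t s x, dsp m t s x = A m t ((A m s).symm (repr x)) - repr x := ⟨_, fun _ _ _ _ => rfl⟩
  -- the partial sums of the level fields are the tower velocities
  have hsum : ∀ m t z, ∑ i ∈ Finset.range m, bf (i + 1) t (proj z) = Bs m t z := by
    intro m
    induction m with
    | zero => intro t z; simp [hB0]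
    | succ n ih =>
      intro t z
      rw [Finset.sum_range_succ, ih, hBsucc, hbS]
      -- periodicity of the inserted velocity through `repr ∘ proj`
      have hper : ∀ y (k' : Fin 3 → ℤ), INS n (A n) t (y + latticeVec k') = INS n (A n) t y := fun y k' =>
        inserted_add_latticeVec (A n) (v (n + 1)) t _ (hINV n).1 (hvper _) y k'
      simp only []
      rw [periodic_repr_proj hper]
  -- smoothness of the tower at all orders
  have hAinf : ∀ m t, ContDiff ℝ ∞ (A m t) ∧ ContDiff ℝ ∞ (A m t).symm := fun m t => by
    obtain ⟨-, i3, i3', -, -, -, -, -, -, -, -, -⟩ := hINV m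
    constructor
    · refine contDiff_infty.2 fun n => ?_
      obtain ⟨ε, hε, hR1, -⟩ := i3 (max n 1) (le_max_right _ _) t
      have h := hR1.comp_contDiff (contDiff_const.prodMk contDiff_id) fun _ => ⟨⟨le_rfl, by linarith⟩, mem_univ _⟩
      exact h.of_le (by exact_mod_cast le_max_left n 1)
    · refine contDiff_infty.2 fun n => ?_
      obtain ⟨ε, hε, hR1, -⟩ := i3' (max n 1) (le_max_right _ _) t
      have h := hR1.comp_contDiff (contDiff_const.prodMk contDiff_id) fun _ => ⟨⟨le_rfl, by linarith⟩, mem_univ _⟩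
      exact h.of_le (by exact_mod_cast le_max_left n 1)
  have hXeqm : ∀ m t s z (k' : Fin 3 → ℤ), A m t ((A m s).symm (z + latticeVec k')) = A m t ((A m s).symm z) + latticeVec k' :=
    fun m t s z k' => by rw [equivariant_symm ((hINV m).1 s), (hINV m).1]
  refine ⟨⟨E.toFractalCarrierData, E.refresh, E.θ, bf, dsp, E.refresh_pos, E.θ_pos⟩, rfl, rfl, rfl, fun m => ⟨?_, ?_⟩,
    fun m t => ?_, fun m t s => ?_, fun m s => ?_, fun m t s r => ?_⟩
  · -- `IsFlow m`: the integral form of the flow equation of `A m`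
    intro t s x
    obtain ⟨i1, i3, -, i4, -, -, i5, i7a, i7b, i7c, -, -⟩ := hINV m
    have i3₁ := i3 1 le_rfl
    set z₀ : EuclideanSpace ℝ (Fin 3) := (A m s).symm (repr x) with hz₀
    show dsp m t s x = ∫ r in s..t, ∑ i ∈ Finset.range m, bf (i + 1) r (x + proj (dsp m r s x))
    have hX : ∀ r, x + proj (dsp m r s x) = proj (A m r z₀) := fun r => by
      rw [hdsp]; exact add_proj_disp_eq (fun y => A m r ((A m s).symm y)) x
    simp only [hX, hsum]
    have hcontA : Continuous fun r => A m r z₀ := continuous_apply_of_slabs (A m) i3₁ z₀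
    have hcont : Continuous fun r => A m r z₀ - repr x := hcontA.sub continuous_const
    have hderiv : ∀ r ∉ Ds m, HasDerivAt (fun r => A m r z₀ - repr x) (Bs m r (A m r z₀)) r :=
      fun r hr => (i5 r hr z₀).sub_const _
    have hint : ∀ a b : ℝ, IntervalIntegrable (fun r => Bs m r (A m r z₀)) volume a b := by
      refine intervalIntegrable_of_bounded_of_continuousAt_off_countable i4 (fun r hr => ?_) (fun a b => ?_)
      · exact ContinuousAt.comp_of_eq (i7c r hr (A m r z₀)) (continuous_id.prodMk hcontA).continuousAt rfl
      · obtain ⟨C, hC⟩ := i7b a b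
        exact ⟨C, fun r hr => hC r hr _⟩
    rw [integral_eq_sub_of_hasDerivAt_off_countable i4 hcont hderiv hint s t, hdsp]
    have hFs : A m s z₀ = repr x := by rw [hz₀]; exact Equiv.apply_symm_apply _ _
    rw [hFs, sub_self, sub_zero]
  · -- `IsInserted m`: the level `m+1` field is the pushed-forward Eulerian level, window by window
    intro j t ht y
    obtain ⟨i1, -, -, -, -, -, -, -, -, -, -, -⟩ := hINV m
    have hAc : ∀ τ, ContDiff ℝ 1 (A m τ) ∧ ContDiff ℝ 1 (A m τ).symm := fun τ =>
      ⟨(hAinf m τ).1.of_le (by exact_mod_cast le_top), (hAinf m τ).2.of_le (by exact_mod_cast le_top)⟩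
    set s : ℝ := (j : ℝ) * E.refresh (m + 1) with hs
    -- the frame: equivariance and smoothness of `X(t, s) = A t ∘ (A s)⁻¹`
    have hXeq : ∀ z (k' : Fin 3 → ℤ), A m t ((A m s).symm (z + latticeVec k')) = A m t ((A m s).symm z) + latticeVec k' :=
      fun z k' => by rw [equivariant_symm (i1 s), i1]
    have hXd : Differentiable ℝ fun z => A m t ((A m s).symm z) :=
      ((hAc t).1.comp (hAc s).2).differentiable (by simp)
    show bf (m + 1) t (y + proj (dsp m t s y)) =
      (ContinuousLinearMap.id ℝ (EuclideanSpace ℝ (Fin 3)) + fderiv ℝ (Torus.lift (dsp m t s)) (repr y))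
        (E.toFractalCarrierData.level (m + 1) t y)
    -- left-hand side: the inserted velocity at the pushed point
    have hX : y + proj (dsp m t s y) = proj (A m t ((A m s).symm (repr y))) := by
      rw [hdsp]; exact add_proj_disp_eq (fun y' => A m t ((A m s).symm y')) y
    have hper : ∀ z (k' : Fin 3 → ℤ), INS m (A m) t (z + latticeVec k') = INS m (A m) t z := fun z k' =>
      inserted_add_latticeVec (A m) (v (m + 1)) t _ i1 (hvper _) z k'
    have hfl : ⌊t / E.refresh (m + 1)⌋ = j := floor_eq_of_mem_Ico (E.refresh_pos _) ht
    rw [hX, hbS, periodic_repr_proj hper]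
    simp only [INS, hfl, ← hs, Equiv.symm_apply_apply, Equiv.apply_symm_apply, hv, proj_repr]
    -- right-hand side: the derivative of the lifted displacement
    have hl : Torus.lift (dsp m t s) = fun z => A m t ((A m s).symm z) - z := by
      funext z
      have e : dsp m t s = fun x => (fun y' => A m t ((A m s).symm y')) (repr x) - repr x := funext fun x => hdsp m t s x
      rw [e]
      exact lift_disp_eq (F := fun y' => A m t ((A m s).symm y')) hXeq z
    have hF : HasFDerivAt (fun z => A m t ((A m s).symm z) - z)
        (fderiv ℝ (fun y' => A m t ((A m s).symm y')) (repr y) - ContinuousLinearMap.id ℝ (EuclideanSpace ℝ (Fin 3)))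
        (repr y) := ((hXd _).hasFDerivAt).sub (hasFDerivAt_id _)
    rw [hl, hF.fderiv]
    simp

  · -- (L3a) every level field is smooth in space
    show ContDiff ℝ ∞ (Torus.lift (bf (m + 1) t))
    have hper : ∀ z (k' : Fin 3 → ℤ), INS m (A m) t (z + latticeVec k') = INS m (A m) t z := fun z k' =>
      inserted_add_latticeVec (A m) (v (m + 1)) t _ (hINV m).1 (hvper _) z k'
    have hl : Torus.lift (bf (m + 1) t) = INS m (A m) t := by
      funext z; rw [Torus.lift_apply, hbS, periodic_repr_proj hper]
    rw [hl]
    set w : ℝ := (⌊t / E.refresh (m + 1)⌋ : ℝ) * E.refresh (m + 1) with hw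
    have hF : ContDiff ℝ ∞ fun y => A m t ((A m w).symm y) := (hAinf m t).1.comp (hAinf m w).2
    have hq : ContDiff ℝ ∞ fun z => A m w ((A m t).symm z) := (hAinf m w).1.comp (hAinf m t).2
    have hvs : ContDiff ℝ ∞ fun y => v (m + 1) t y := by
      have e : (fun y => v (m + 1) t y) = Torus.lift (E.toFractalCarrierData.level (m + 1) t) :=
        funext fun y => by rw [hv, Torus.lift_apply]
      rw [e]; exact isSmooth_level _ _ _
    have hD : ContDiff ℝ ∞ fun p : EuclideanSpace ℝ (Fin 3) × EuclideanSpace ℝ (Fin 3) =>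
        fderiv ℝ (fun y => A m t ((A m w).symm y)) p.1 p.2 := hF.contDiff_fderiv_apply (by simp)
    exact hD.comp (hq.prodMk (hvs.comp hq))
  · -- (F1b) every displacement is smooth in space
    show ContDiff ℝ ∞ (Torus.lift (dsp m t s))
    have hl : Torus.lift (dsp m t s) = fun z => A m t ((A m s).symm z) - z := by
      funext z
      have e : dsp m t s = fun x => (fun y' => A m t ((A m s).symm y')) (repr x) - repr x := funext fun x => hdsp m t s x
      rw [e]
      exact lift_disp_eq (F := fun y' => A m t ((A m s).symm y')) (hXeqm m t s) z
    rw [hl]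
    exact ((hAinf m t).1.comp (hAinf m s).2).sub contDiff_id
  · -- (F2a) `X m s s = id`
    funext x
    show x + proj (dsp m s s x) = x
    rw [hdsp, add_proj_disp_eq (fun y' => A m s ((A m s).symm y')) x]
    simp only [Equiv.apply_symm_apply, proj_repr]
  · -- (F2b) the two-parameter group law
    funext x
    show (x + proj (dsp m s r x)) + proj (dsp m t s (x + proj (dsp m s r x))) = x + proj (dsp m t r x)
    rw [hdsp m s r, add_proj_disp_eq (fun y' => A m s ((A m r).symm y')) x]
    rw [hdsp m t s, add_proj_disp_eq (fun y' => A m t ((A m s).symm y')) _]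
    rw [hdsp m t r, add_proj_disp_eq (fun y' => A m t ((A m r).symm y')) x]
    obtain ⟨k', hk'⟩ := exists_repr_proj_eq_add_latticeVec_holds (A m s ((A m r).symm (repr x)))
    rw [hk', hXeqm m t s, Torus.proj_add_latticeVec]
    simp

end Summit.AnomalousDissipation.AnomalousDissipation.Theorems.SolenoidalFractalHomogenisation.LagrangianCarrierConstruction

end
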